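import Mathlib
import Literature.Computability.Complexity.FourierDegreeAlgebra
import HarnessLib

/-!
# Barrier: bounded low-degree moment matching fails on majority (cube model of the cell's (BSM))

Fifth barrier file of the cell pnp-psdrank (route `ChebyshevTracialDesign`, crux `TracialDecayExp20` = stmt-PneNP-19878),
companion of the prover's MEMO-21 §3(a) and of lit memo LIT-41. MEMO-21 prices the "amplitude class" of cut fields
`f·BBᵀ` (a `[0,1]`-valued mask `f` times a low-degree Gram field) by SIGN-REPRESENTATIVES as soon as
  (BSM) «every mask `f` has a bounded sum of squares `g` of low degree whose low moments match those of `f`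
        to accuracy `e^{−aD}`»; in dual form: «for every low-degree `φ` with `E φ² = 1`,
        `E[φ₊] − sup_g E[φ g] ≤ e^{−aD}` over `[0,1]`-valued `g` of degree `≤ d`»,
and sketches ("very likely false") that halfspace masks defeat it. THIS FILE PROVES the failure in the CUBE MODEL
(`{0,1}^m`, uniform measure, Walsh degree), for the simplest halfspace — MAJORITY — at EVERY degree `d < m`, with an
explicit inverse-polynomial deficiency, by a five-line argument that needs no anticoncentration and no Fourier-tail
asymptotics:
* `linSum x = Σ_i χ_{i}(x) = m − 2·#{i : x_i = 1}` (`linSum_eq`), an ODD integer when `m` is odd, so `|linSum| ≥ 1`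
  (`one_le_abs_linSum`); `majInd = 1[linSum > 0]`;
* pointwise `(1[φ>0] − a)² ≤ φ·(1[φ>0] − a)` for `a ∈ [0,1]`, `|φ| ≥ 1` (`sq_sub_le_linSum_mul_sub`);
* the TOP WALSH COEFFICIENT OF MAJORITY: `Σ_x 1[linSum x > 0]·χ_{[m]}(x) = (−1)^{m'}·C(2m', m')` for `m = 2m'+1`
  (`sum_majInd_mul_walsh_univ`; = `2^{m−1}·\widehat{Maj_m}([m])`, O'Donnell's Thm 5.19/Cor 5.20: the top coefficient
  of majority equals its degree-one coefficient `2^{1−m} C(m−1,(m−1)/2)` up to sign), via the partial alternating row sum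
  `Σ_{k≤M} (−1)^k C(n+1,k) = (−1)^M C(n,M)` (`alternating_partial_sum`) and the weight count `Σ_x F(#x) = Σ_k C(m,k)F(k)`;
* Cauchy–Schwarz against the single character `χ_{[m]}`, to which every `g` of degree `< m` is orthogonal:
  **`sum_linSum_mul_sub_ge`**: `Σ_x linSum(x)·(majInd(x) − g(x)) ≥ C(2m',m')²/2^m` for every `g : {0,1}^m → [0,1]` with
  `Σ_x g χ_{[m]} = 0`; in expectation form with the explicit floor `4^{m'} ≤ (2m'+2)·C(2m',m')`:
  **`expect_linSum_mul_sub_ge`**: `E_x[linSum·(majInd − g)] ≥ 1/(16 (m'+1)²)` (`IsLevelLE d g`, `d < m`);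
* the TECHNIQUE CLASS `CubeMomentMatching m d ε` (dual (BSM) on the cube, already for test functions `φ` of degree `1`) and
  the BARRIER **`not_cubeMomentMatching`**: it fails for every `d < m = 2m'+1` and every `ε < 1/(16 (m'+1)² √m)`
  (normalised witness `φ = linSum/√m`, `E φ² = 1`).

technique_class: SIGN-REPRESENTATIVE PRICING OF AMPLITUDE MASKS VIA BOUNDED LOW-DEGREE MOMENT MATCHING — «for every
  `φ : {0,1}^m → ℝ` of Walsh degree ≤ 1 with `E φ² = 1` there is `g : {0,1}^m → [0,1]` of Walsh degree `≤ d` with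
  `E[φ·(1[φ>0] − g)] ≤ ε`» (`CubeMomentMatching m d ε`); the cell's (BSM) (MEMO-21 §3(a)) is the slice version with `φ` of
  degree `≤ D′`, `g` a bounded SOS with factors of degree `c″` (function degree `2c″`) and `ε = e^{−aD}`.
  [cite: ODonnell2014, Thm. 5.19 and Cor. 5.20 (§5.3: Fourier coefficients of majority)]
blocks: the route «(BSM) ⇒ the amplitude class `𝒜_k = {f·BBᵀ}` is priced by bricks 94b+95+96+slack» of MEMO-21 §3(a)–(b), in the
  cube model, for every degree `d < m` and accuracy below `1/(16(m'+1)²√m)` — an inverse POLYNOMIAL, whereas the route needs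
  `e^{−a·D}` with `D → ∞`; masks as simple as majority of `d+1` coordinates (a junta of Walsh degree `d+1`, one above the SIGN
  budget when `d+1+k > c′`) are not moment-matched by any `[0,1]`-valued function of degree `≤ d`.
because: `φ(f−g) = |φ||f−g| ≥ |f−g| ≥ (f−g)²` pointwise (`|φ| ≥ 1`: odd integer; `0 ≤ g ≤ 1`), and
  `E(f−g)² ≥ (E[(f−g)χ_{[m]}])² = f̂([m])²` by Cauchy–Schwarz, `g ⟂ χ_{[m]}`; `|f̂([m])| = C(m−1,(m−1)/2)/2^m ≥ 1/(4(m'+1))`.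
  [cite: ODonnell2014, Thm. 5.19 and Cor. 5.20 (§5.3)]
evasions_known: (i) masks whose Walsh degree is within the SIGN budget are priced directly (cell brick 96 `value_le_of_boolMask`,
  `Summit.PneNP.PneNP.Theorems.ChebyshevTracialDesignLowDegreeMasks`) — majority of `h` coordinates has degree exactly `h`, so the
  barrier and brick 96 are complementary in `h`; (ii) the cell's r-free ladder CG_k (MEMO-21 §3(b)–(c), bricks 98–100: reduction of
  CG_1 to pair-symmetric tests) does not go through representatives and is untouched; (iii) accuracy: at the cell's DESIGN scales
  (`n ≤ 2304`, `D ≤ 6`) the slice analogue's deficiency is below `e^{−aD}` for `a ≤ 2.4` (LIT-41 §3) — the obstruction is asymptotic,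
  like the crux. "none published" otherwise. [cite: ODonnell2014, §5.3]
scope_caveats: CUBE `{0,1}^m` with the uniform measure and Walsh degree; `φ` restricted to degree 1 (which only strengthens the
  refutation); the bound `1/(16(m'+1)²)` is not optimised (truth: `C(2m',m')²/4^m ≍ 1/(πm)`). The cell's object lives on the SLICE
  `C([n],t)` with Johnson degree; there the same five lines run through the hypergeometric law of `|U∩H|` and the top Hahn vector
  (LIT-41 §1, exact deficiency `δ(n,t,|H|)`; formalised in the companion file `MajorityMomentMatchingSlice.lean`:
  `expect_blockSum_mul_sub_ge`, `not_sliceMomentMatching`). Nothing here bears on the crux `TracialDecayExp20` or on CG_k.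
status: established (elementary; this file).

Label: barrier / instrument for cell pnp-psdrank; no P-vs-NP content. No instances, no notation, standard axioms, no facts.
-/

noncomputable section

open Finset
open Literature.Probability.RandomGraphs.LowDegree (walsh sgn)
open Literature.Computability.Complexity.LowDegree (cubeFourierCoeff IsLevelLE isLevelLE_walsh)

namespace Literature.Barriers.PneNP.MajorityMomentMatching

variable {m : ℕ}

/-! ### The witness: the degree-one form `Σ_i χ_i` and the majority indicator -/

/-- Hamming weight `#{i : x_i = 1}` of a cube point. [cite: ODonnell2014, §5.3 (majority is symmetric: coefficients depend on |S|)] -/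
def weight (x : Fin m → Bool) : ℕ := (univ.filter fun i => x i = true).card

/-- The linear form `φ(x) = Σ_i χ_{i}(x) = Σ_i (−1)^{x_i}` (Walsh degree 1). [cite: ODonnell2014, §5.3 (Maj_n = sgn(Σ x_i))] -/
def linSum (x : Fin m → Bool) : ℝ := ∑ i, sgn (x i)

/-- The majority indicator `f = 1[φ > 0]` (for odd `m`: `#{i : x_i = 1} < m/2`; `{0,1}`-valued version of `Maj_m`).
[cite: ODonnell2014, §5.3] -/
def majInd (x : Fin m → Bool) : ℝ := if 0 < linSum x then 1 else 0

/-- `sgn b = 1 − 2·[b]`. [folklore] -/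
private theorem sgn_eq_one_sub (b : Bool) : sgn b = 1 - 2 * (if b = true then (1 : ℝ) else 0) := by
  cases b <;> norm_num [sgn]

/-- `φ(x) = m − 2·#{i : x_i = 1}`. [cite: ODonnell2014, §5.3] -/
theorem linSum_eq (x : Fin m → Bool) : linSum x = (m : ℝ) - 2 * (weight x : ℝ) := by
  unfold linSum weight
  simp_rw [sgn_eq_one_sub]
  rw [sum_sub_distrib, sum_const, card_univ, Fintype.card_fin, nsmul_eq_mul, mul_one, ← mul_sum,
    ← natCast_card_filter]

/-- For odd `m` the form `φ` is an odd integer, hence `|φ| ≥ 1` everywhere. [cite: ODonnell2014, §5.3 (n odd)] -/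
theorem one_le_abs_linSum (hm : Odd m) (x : Fin m → Bool) : 1 ≤ |linSum x| := by
  have hz : linSum x = (((m : ℤ) - 2 * (weight x : ℤ) : ℤ) : ℝ) := by
    rw [linSum_eq]; push_cast; ring
  have hodd : Odd ((m : ℤ) - 2 * (weight x : ℤ)) := hm.natCast.sub_even (even_two_mul _)
  have hne : ((m : ℤ) - 2 * (weight x : ℤ)) ≠ 0 := by
    rintro h; rw [h] at hodd; exact (Int.not_odd_iff_even.2 (by decide : Even (0 : ℤ))) hodd
  rw [hz, ← Int.cast_abs]
  exact_mod_cast Int.one_le_abs hne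

/-- The pointwise step: for `a ∈ [0,1]` and `|φ| ≥ 1`, `(1[φ>0] − a)² ≤ φ·(1[φ>0] − a)` (`φ(f−a) = |φ|·|f−a| ≥ |f−a| ≥ (f−a)²`).
[cite: ODonnell2014, §5.3] -/
theorem sq_sub_le_linSum_mul_sub (hm : Odd m) (x : Fin m → Bool) {a : ℝ} (ha0 : 0 ≤ a) (ha1 : a ≤ 1) :
    (majInd x - a) ^ 2 ≤ linSum x * (majInd x - a) := by
  have h1 := one_le_abs_linSum hm x
  unfold majInd
  by_cases hpos : 0 < linSum x
  · rw [if_pos hpos]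
    rw [abs_of_pos hpos] at h1
    nlinarith
  · rw [if_neg hpos]
    have hneg : linSum x ≤ -1 := by
      rw [abs_of_nonpos (not_lt.1 hpos)] at h1; linarith
    nlinarith

/-! ### The top Walsh coefficient of majority -/

/-- `χ_{[m]}(x) = (−1)^{#{i : x_i = 1}}`. [cite: ODonnell2014, §1.2 (χ_S(x) = Π_{i∈S} x_i)] -/
theorem walsh_univ_eq_neg_one_pow (x : Fin m → Bool) : walsh univ x = (-1) ^ weight x := by
  unfold walsh weight
  rw [prod_ite_eq_of_filter]
  · simp [prod_const]
  where
  /-- plumbing: `Π_i sgn(x_i) = Π_{i : x_i} (−1)`. [folklore] -/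
  prod_ite_eq_of_filter : ∏ i ∈ (univ : Finset (Fin m)), sgn (x i) =
      ∏ i ∈ univ.filter (fun i => x i = true), (-1 : ℝ) := by
    rw [prod_filter]
    refine prod_congr rfl fun i _ => ?_
    cases x i <;> simp [sgn]

/-- Reindexing a symmetric sum over the cube by weight: `Σ_x F(#x) = Σ_k C(m,k)·F(k)`.
[cite: ODonnell2014, §5.3 (symmetric functions)] -/
theorem sum_cube_weight (F : ℕ → ℝ) :
    ∑ x : Fin m → Bool, F (weight x) = ∑ k ∈ range (m + 1), (m.choose k : ℝ) * F k := by
  classical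
  -- transport along `x ↦ {i : x_i = 1}`
  let e : (Fin m → Bool) ≃ Finset (Fin m) :=
    { toFun := fun x => univ.filter fun i => x i = true
      invFun := fun U i => decide (i ∈ U)
      left_inv := fun x => by funext i; simp
      right_inv := fun U => by ext i; simp }
  have h1 : ∑ x : Fin m → Bool, F (weight x) = ∑ U : Finset (Fin m), F U.card :=
    Fintype.sum_equiv e _ _ fun x => rfl
  rw [h1, ← powerset_univ, sum_powerset_apply_card, card_univ, Fintype.card_fin]
  simp_rw [nsmul_eq_mul]

/-- The partial alternating row sum `Σ_{k ≤ M} (−1)^k C(n+1, k) = (−1)^M C(n, M)`.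
[cite: ODonnell2014, Thm. 5.19 proof (coefficients of majority via binomial identities)] -/
theorem alternating_partial_sum (n M : ℕ) :
    ∑ k ∈ range (M + 1), (-1 : ℝ) ^ k * ((n + 1).choose k : ℝ) = (-1) ^ M * (n.choose M : ℝ) := by
  induction M with
  | zero => simp
  | succ M ih =>
    rw [sum_range_succ, ih, Nat.choose_succ_succ, Nat.cast_add, pow_succ]
    ring

/-- **The top Walsh coefficient of majority** (`m = 2m'+1`): `Σ_x 1[φ(x)>0]·χ_{[m]}(x) = (−1)^{m'}·C(2m',m')`,
i.e. `\widehat{1[Maj]}([m]) = (−1)^{m'} C(m−1, (m−1)/2)/2^m` — in modulus the degree-one coefficient.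
[cite: ODonnell2014, Thm. 5.19 and Cor. 5.20 (§5.3)] -/
theorem sum_majInd_mul_walsh_univ (m' : ℕ) (hm : m = 2 * m' + 1) :
    ∑ x : Fin m → Bool, majInd x * walsh univ x = (-1) ^ m' * ((2 * m').choose m' : ℝ) := by
  set F : ℕ → ℝ := fun k => (if k < m' + 1 then (1 : ℝ) else 0) * (-1) ^ k with hFdef
  have hF : ∀ x : Fin m → Bool, majInd x * walsh univ x = F (weight x) := by
    intro x
    rw [walsh_univ_eq_neg_one_pow, hFdef]
    unfold majInd
    rw [linSum_eq]
    congr 1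
    have : (0 < (m : ℝ) - 2 * (weight x : ℝ)) ↔ weight x < m' + 1 := by
      constructor
      · intro h
        have : (2 * weight x : ℝ) < m := by linarith
        have : 2 * weight x < m := by exact_mod_cast this
        omega
      · intro h
        have : 2 * weight x < m := by omega
        have : ((2 * weight x : ℕ) : ℝ) < m := by exact_mod_cast this
        push_cast at this; linarith
    simp only [this]
  rw [sum_congr rfl fun x _ => hF x, sum_cube_weight F]
  simp only [hFdef]
  -- split the range at `m' + 1`; the upper part vanishes
  rw [range_eq_Ico, ← sum_Ico_consecutive _ (Nat.zero_le (m' + 1)) (by omega : m' + 1 ≤ m + 1)]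
  have hzero : ∑ k ∈ Ico (m' + 1) (m + 1), (m.choose k : ℝ) * ((if k < m' + 1 then (1 : ℝ) else 0) * (-1) ^ k) = 0 :=
    sum_eq_zero fun k hk => by rw [if_neg (by have := (mem_Ico.1 hk).1; omega)]; ring
  rw [hzero, add_zero, ← range_eq_Ico]
  have hmain : ∑ k ∈ range (m' + 1), (m.choose k : ℝ) * ((if k < m' + 1 then (1 : ℝ) else 0) * (-1) ^ k) =
      ∑ k ∈ range (m' + 1), (-1 : ℝ) ^ k * ((2 * m' + 1).choose k : ℝ) :=
    sum_congr rfl fun k hk => by rw [if_pos (mem_range.1 hk), hm]; ring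
  rw [hmain, alternating_partial_sum]

/-! ### The inequality and the barrier -/

/-- **Majority is not moment-matched by bounded functions orthogonal to the top character**: for `m = 2m'+1` and every
`g : {0,1}^m → [0,1]` with `Σ_x g χ_{[m]} = 0` (e.g. of Walsh degree `< m`),
`Σ_x φ(x)·(1[φ>0](x) − g(x)) ≥ C(2m',m')²/2^m`. [cite: ODonnell2014, Thm. 5.19 and Cor. 5.20 (§5.3)] -/
theorem sum_linSum_mul_sub_ge (m' : ℕ) (hm : m = 2 * m' + 1) (g : (Fin m → Bool) → ℝ)
    (hg : ∀ x, 0 ≤ g x ∧ g x ≤ 1) (htop : ∑ x : Fin m → Bool, g x * walsh univ x = 0) :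
    ((2 * m').choose m' : ℝ) ^ 2 / 2 ^ m ≤ ∑ x : Fin m → Bool, linSum x * (majInd x - g x) := by
  have hodd : Odd m := ⟨m', hm⟩
  -- Σ φ(f−g) ≥ Σ (f−g)²
  have h1 : ∑ x : Fin m → Bool, (majInd x - g x) ^ 2 ≤ ∑ x : Fin m → Bool, linSum x * (majInd x - g x) :=
    sum_le_sum fun x _ => sq_sub_le_linSum_mul_sub hodd x (hg x).1 (hg x).2
  -- Cauchy–Schwarz against χ_{[m]}
  have hcs := sum_mul_sq_le_sq_mul_sq (univ : Finset (Fin m → Bool)) (fun x => majInd x - g x) (fun x => walsh univ x)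
  have hchi : ∑ x : Fin m → Bool, walsh univ x ^ 2 = 2 ^ m := by
    have : ∀ x : Fin m → Bool, walsh univ x ^ 2 = 1 := fun x => by
      rw [walsh_univ_eq_neg_one_pow, ← pow_mul]; exact Even.neg_one_pow ⟨weight x, by ring⟩
    simp [this]
  have hinner : ∑ x : Fin m → Bool, (majInd x - g x) * walsh univ x = (-1) ^ m' * ((2 * m').choose m' : ℝ) := by
    simp_rw [sub_mul]
    rw [sum_sub_distrib, htop, sub_zero, sum_majInd_mul_walsh_univ m' hm]
  rw [hinner, hchi] at hcs
  have hsq : ((-1 : ℝ) ^ m' * ((2 * m').choose m' : ℝ)) ^ 2 = ((2 * m').choose m' : ℝ) ^ 2 := by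
    rw [mul_pow, ← pow_mul, Even.neg_one_pow ⟨m', by ring⟩, one_mul]
  rw [hsq] at hcs
  have h2m : (0 : ℝ) < 2 ^ m := by positivity
  rw [div_le_iff₀ h2m]
  calc ((2 * m').choose m' : ℝ) ^ 2 ≤ (∑ x : Fin m → Bool, (majInd x - g x) ^ 2) * 2 ^ m := hcs
    _ ≤ (∑ x : Fin m → Bool, linSum x * (majInd x - g x)) * 2 ^ m :=
        mul_le_mul_of_nonneg_right h1 h2m.le

/-- A low-degree function is orthogonal to the top character: `IsLevelLE d g`, `d < m` ⇒ `Σ_x g χ_{[m]} = 0`.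
[cite: ODonnell2014, §1.4 (degree)] -/
theorem sum_mul_walsh_univ_eq_zero_of_isLevelLE {d : ℕ} {g : (Fin m → Bool) → ℝ} (hg : IsLevelLE d g) (hd : d < m) :
    ∑ x : Fin m → Bool, g x * walsh univ x = 0 := by
  have h := hg univ (by simpa using hd)
  unfold cubeFourierCoeff at h
  have h2 : (2 : ℝ) ^ m ≠ 0 := by positivity
  rwa [div_eq_zero_iff, or_iff_left h2] at h

/-- The central binomial floor `4^{m'} ≤ (2m'+2)·C(2m',m')` (Mathlib's `4^n ≤ 2n·C(2n,n)` for `n ≥ 1`, and `m' = 0`).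
[cite: ODonnell2014, §5.3 (Stirling estimate for C(n−1,(n−1)/2)/2^{n−1})] -/
theorem four_pow_le_centralBinom (m' : ℕ) : (4 : ℝ) ^ m' ≤ (2 * m' + 2) * ((2 * m').choose m' : ℝ) := by
  rcases Nat.eq_zero_or_pos m' with rfl | hpos
  · norm_num
  · have h := Nat.four_pow_le_two_mul_self_mul_centralBinom m' hpos
    rw [Nat.centralBinom_eq_two_mul_choose] at h
    have h' : ((4 ^ m' : ℕ) : ℝ) ≤ ((2 * m' * (2 * m').choose m' : ℕ) : ℝ) := by exact_mod_cast h
    push_cast at h'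
    have hc : (0 : ℝ) ≤ ((2 * m').choose m' : ℝ) := by positivity
    nlinarith

/-- **Expectation form with an explicit inverse-polynomial floor**: for `m = 2m'+1` and every `g : {0,1}^m → [0,1]` of Walsh
degree `≤ d < m`, `E_x[φ·(1[φ>0] − g)] ≥ 1/(16 (m'+1)²)`. [cite: ODonnell2014, Thm. 5.19 and Cor. 5.20 (§5.3)] -/
theorem expect_linSum_mul_sub_ge (m' : ℕ) (hm : m = 2 * m' + 1) {d : ℕ} (hd : d < m) (g : (Fin m → Bool) → ℝ)
    (hg : ∀ x, 0 ≤ g x ∧ g x ≤ 1) (hdeg : IsLevelLE d g) :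
    1 / (16 * ((m' : ℝ) + 1) ^ 2) ≤ (∑ x : Fin m → Bool, linSum x * (majInd x - g x)) / 2 ^ m := by
  have hmain := sum_linSum_mul_sub_ge m' hm g hg (sum_mul_walsh_univ_eq_zero_of_isLevelLE hdeg hd)
  have h2m : (0 : ℝ) < 2 ^ m := by positivity
  rw [le_div_iff₀ h2m]
  refine le_trans ?_ hmain
  rw [le_div_iff₀ h2m]
  -- `2^m · 2^m = 4 · 16^{m'}` and `16^{m'} = (4^{m'})² ≤ ((2m'+2) C)²`
  have h2 : (2 : ℝ) ^ m = 2 * 4 ^ m' := by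
    rw [hm, pow_succ, pow_mul]; norm_num; ring
  have hpow : (2 : ℝ) ^ m * 2 ^ m = 4 * ((4 : ℝ) ^ m') ^ 2 := by rw [h2]; ring
  have hC := four_pow_le_centralBinom m'
  have h4 : (0 : ℝ) ≤ 4 ^ m' := by positivity
  have hsq : ((4 : ℝ) ^ m') ^ 2 ≤ ((2 * m' + 2) * ((2 * m').choose m' : ℝ)) ^ 2 := pow_le_pow_left₀ h4 hC 2
  have hm1 : (0 : ℝ) < 16 * ((m' : ℝ) + 1) ^ 2 := by positivity
  calc 1 / (16 * ((m' : ℝ) + 1) ^ 2) * 2 ^ m * 2 ^ m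
      = 4 * ((4 : ℝ) ^ m') ^ 2 / (16 * ((m' : ℝ) + 1) ^ 2) := by rw [mul_assoc, hpow]; ring
    _ ≤ 4 * ((2 * m' + 2) * ((2 * m').choose m' : ℝ)) ^ 2 / (16 * ((m' : ℝ) + 1) ^ 2) := by
        gcongr
    _ = ((2 * m').choose m' : ℝ) ^ 2 := by
        field_simp
        ring

/-- **The technique class** (cube model of (BSM), dual form, already for degree-one test forms): every `φ` of Walsh degree
`≤ 1` with `E φ² = 1` admits a `[0,1]`-valued `g` of Walsh degree `≤ d` with `E[φ·(1[φ>0] − g)] ≤ ε`.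
[cite: ODonnell2014, §5.3] -/
def CubeMomentMatching (m d : ℕ) (ε : ℝ) : Prop :=
  ∀ φ : (Fin m → Bool) → ℝ, IsLevelLE 1 φ → (∑ x, φ x ^ 2) = 2 ^ m →
    ∃ g : (Fin m → Bool) → ℝ, (∀ x, 0 ≤ g x ∧ g x ≤ 1) ∧ IsLevelLE d g ∧
      (∑ x, φ x * ((if 0 < φ x then 1 else 0) - g x)) / 2 ^ m ≤ ε

/-- `φ = Σ_i χ_i` has Walsh degree `1`. [cite: ODonnell2014, §1.4] -/
theorem isLevelLE_linSum : IsLevelLE 1 (linSum (m := m)) := by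
  have : (linSum (m := m)) = fun x => ∑ i : Fin m, walsh {i} x := by
    funext x; simp [linSum, walsh]
  rw [this]
  have h := IsLevelLE.sum (univ : Finset (Fin m)) (g := fun i : Fin m => walsh ({i} : Finset (Fin m)))
    (d := 1) (fun i _ => isLevelLE_walsh {i} (by simp))
  convert h using 1

/-- `Σ_x φ(x)² = m·2^m` (orthogonality of the `χ_i`). [cite: ODonnell2014, Thm. 1.5 (Parseval)] -/
theorem sum_linSum_sq : ∑ x : Fin m → Bool, linSum x ^ 2 = (m : ℝ) * 2 ^ m := by
  have hexp : ∀ x : Fin m → Bool, linSum x ^ 2 = ∑ i : Fin m, ∑ j : Fin m, walsh {i} x * walsh {j} x := by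
    intro x
    rw [sq, linSum, sum_mul_sum]
    refine sum_congr rfl fun i _ => sum_congr rfl fun j _ => ?_
    simp [walsh]
  simp_rw [hexp]
  rw [sum_comm]
  simp_rw [sum_comm (s := (univ : Finset (Fin m → Bool)))]
  rw [show ∑ i : Fin m, ∑ j : Fin m, ∑ x : Fin m → Bool, walsh {i} x * walsh {j} x =
      ∑ i : Fin m, ∑ j : Fin m, (if ({i} : Finset (Fin m)) = {j} then (2 : ℝ) ^ m else 0) from
    sum_congr rfl fun i _ => sum_congr rfl fun j _ =>
      Literature.Computability.Complexity.LowDegree.sum_walsh_mul_walsh_index {i} {j}]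
  simp [Finset.singleton_inj, sum_ite_eq]

/-- **BARRIER: bounded low-degree moment matching fails on the cube.** For `m = 2m'+1`, every `d < m` and every
`ε < 1/(16 (m'+1)² √m)`, `CubeMomentMatching m d ε` is false — witnessed by `φ = (Σ_i χ_i)/√m` (majority's halfspace).
[cite: ODonnell2014, Thm. 5.19 and Cor. 5.20 (§5.3)] -/
theorem not_cubeMomentMatching (m' d : ℕ) (hm : m = 2 * m' + 1) (hd : d < m) {ε : ℝ}
    (hε : ε < 1 / (16 * ((m' : ℝ) + 1) ^ 2 * Real.sqrt m)) : ¬ CubeMomentMatching m d ε := by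
  intro h
  have hmpos : (0 : ℝ) < m := by rw [hm]; positivity
  have hs : 0 < Real.sqrt m := Real.sqrt_pos.2 hmpos
  set φ : (Fin m → Bool) → ℝ := fun x => linSum x / Real.sqrt m with hφ
  have hφdeg : IsLevelLE 1 φ := by
    have := (isLevelLE_linSum (m := m)).const_mul (1 / Real.sqrt m)
    convert this using 1
    funext x; simp [hφ, div_eq_inv_mul]
  have hφnorm : ∑ x, φ x ^ 2 = 2 ^ m := by
    simp_rw [hφ, div_pow, Real.sq_sqrt hmpos.le, ← sum_div, sum_linSum_sq]
    field_simp
  obtain ⟨g, hg, hgdeg, hgε⟩ := h φ hφdeg hφnorm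
  -- `1[φ > 0] = majInd` and `Σ φ(f−g) = (Σ linSum (f−g))/√m`
  have hind : ∀ x, (if 0 < φ x then (1 : ℝ) else 0) = majInd x := by
    intro x; unfold majInd; simp only [hφ, div_pos_iff_of_pos_right hs]
  simp_rw [hind] at hgε
  have hsum : ∑ x, φ x * (majInd x - g x) = (∑ x, linSum x * (majInd x - g x)) / Real.sqrt m := by
    rw [sum_div]; refine sum_congr rfl fun x _ => ?_; simp [hφ]; ring
  rw [hsum, div_div, mul_comm (Real.sqrt m), ← div_div] at hgε
  have hlow := expect_linSum_mul_sub_ge m' hm hd g hg hgdeg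
  have : 1 / (16 * ((m' : ℝ) + 1) ^ 2) / Real.sqrt m ≤ ε := le_trans (div_le_div_of_nonneg_right hlow hs.le) hgε
  rw [div_div] at this
  linarith

end Literature.Barriers.PneNP.MajorityMomentMatching

end
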